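import Summits.HodgeConjecture.CorCM.IrreducibleOddWeightsShadowModulesCharacters
import HarnessLib

/-!
# Shadow modules, XII: distinct quadratic characters are INVISIBLE — `S(a₀ + a₀′) ∩ S(a₁ + a₁′) = S(a₀) ∩ S(a₁)` when the
# two lines `S(a₀′)`, `S(a₁′)` are disjoint; the defect of such shadows is `0` or `dim A₀`

COR-CM (cell `pub-hodgecm2`, binder seat `b16` gen 69, count-neutral claim ROW SPACES OVER THE COMMUTANT, file Q11b —
abstract `G`-set level; theorems only, no definition, no named fact, no `sorry`).  NEW as stated, hence under `Summits/`.
HONEST FRAMING: file Q11's linear algebra (sum formula, line lemmas) + Q3's meet theorem, plugged into gen 68's two-sided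
shadow formula for type ranks; the first REDUCIBLE case of the defect (shadow module = irreducible of dimension `≥ 2` ⊕ a
stable line); `HC_CM` is neither used nor asserted.  Census (this generation, base #24, `Anti = χ ⊕ V` on both sides with
DIFFERENT characters `χ₀ ≠ χ₁`): defect values `{2} = {dim V}` to index 11, as the theorem says.

* **`span_shadowCoeff_add_inf_eq_of_lines_disjoint`** — `a_κ ∈ A_κ` stable irreducible of dimension `≠ 1`, `a_κ′ ∈ A_κ′`
  stable lines (`κ = 0, 1`, on two `G`-sets), `S(a₀′) ∩ S(a₁′) = 0` ⟹ `S(a₀ + a₀′) ∩ S(a₁ + a₁′) = S(a₀) ∩ S(a₁)`: right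
  translations act on the two lines by two characters which DIFFER somewhere (else the lines coincide), and that group
  element separates the line components from `S(a₀) + S(a₁)` (Q11 `inf_sup_eq_bot_of_finrank_eq_one`).
* `finrank_inf_eq_zero_or_eq_of_lines_disjoint` (`∈ {0, dim A₀}`, Q3) and the type-rank form
  **`typeRank_add_typeRank_eq_or_of_lines_disjoint`**: for two slots whose shadows decompose as `w_κ = a_κ + a_κ′` in this
  way, `rank Φ₀ + rank Φ₁ − rank(Φ₀,Φ₁) − 1 ∈ {0, dim A₀}` — the quadratic characters never contribute unless shared.

## References

* [Gordon1999HodgeAVSurvey] B. B. Gordon, *A survey of the Hodge conjecture for abelian varieties*, §3 Theorem (proof),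
  7.5–7.7, 9.4.3.
* [Serre1977] J.-P. Serre, *Linear Representations of Finite Groups*, GTM 42, §2.2, §2.6.
-/

set_option autoImplicit false

noncomputable section

open scoped BigOperators Classical

universe u v v' v'' w

namespace Summit.HodgeConjecture.CorCM.IrrOdd

open Literature.NumberTheory.ComplexMultiplication

variable {G : Type w} [Group G] {Y₀ : Type v'} [MulAction G Y₀] [Fintype Y₀] [DecidableEq Y₀]
  {Y₁ : Type v''} [MulAction G Y₁] [Fintype Y₁] [DecidableEq Y₁]

omit [DecidableEq Y₀] [DecidableEq Y₁] in
/-- **DISTINCT QUADRATIC CHARACTERS ARE INVISIBLE**: `a_κ` in stable irreducible modules of dimension `≠ 1`, `a_κ′` in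
stable lines, the two lines `S(a₀′)`, `S(a₁′)` disjoint ⟹ `S(a₀ + a₀′) ∩ S(a₁ + a₁′) = S(a₀) ∩ S(a₁)`.
[cite: Serre1977, §2.2 and §2.6] [cite: Gordon1999HodgeAVSurvey, §3 Theorem (proof)] -/
theorem span_shadowCoeff_add_inf_eq_of_lines_disjoint {A A' : Submodule ℚ (Y₀ → ℚ)} {B B' : Submodule ℚ (Y₁ → ℚ)}
    (hAst : ∀ (k : G) (a : Y₀ → ℚ), a ∈ A → (fun y => a (k • y)) ∈ A)
    (hirrA : ∀ W : Submodule ℚ (Y₀ → ℚ), W ≤ A → W ≠ ⊥ →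
      (∀ (k : G) (f : Y₀ → ℚ), f ∈ W → (fun y => f (k • y)) ∈ W) → W = A)
    (hA1 : Module.finrank ℚ A ≠ 1)
    (hAst' : ∀ (k : G) (a : Y₀ → ℚ), a ∈ A' → (fun y => a (k • y)) ∈ A') (hA'1 : Module.finrank ℚ A' = 1)
    (hBst : ∀ (k : G) (b : Y₁ → ℚ), b ∈ B → (fun y => b (k • y)) ∈ B)
    (hirrB : ∀ W : Submodule ℚ (Y₁ → ℚ), W ≤ B → W ≠ ⊥ →
      (∀ (k : G) (f : Y₁ → ℚ), f ∈ W → (fun y => f (k • y)) ∈ W) → W = B)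
    (hB1 : Module.finrank ℚ B ≠ 1)
    (hBst' : ∀ (k : G) (b : Y₁ → ℚ), b ∈ B' → (fun y => b (k • y)) ∈ B') (hB'1 : Module.finrank ℚ B' = 1)
    {a a' : Y₀ → ℚ} {b b' : Y₁ → ℚ} (ha : a ∈ A) (ha' : a' ∈ A') (hb : b ∈ B) (hb' : b' ∈ B')
    (hll : Submodule.span ℚ (Set.range fun y : Y₀ => fun g : G => a' (g • y)) ⊓
      Submodule.span ℚ (Set.range fun y : Y₁ => fun g : G => b' (g • y)) = ⊥) :
    Submodule.span ℚ (Set.range fun y : Y₀ => fun g : G => (a + a') (g • y)) ⊓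
        Submodule.span ℚ (Set.range fun y : Y₁ => fun g : G => (b + b') (g • y)) =
      Submodule.span ℚ (Set.range fun y : Y₀ => fun g : G => a (g • y)) ⊓
        Submodule.span ℚ (Set.range fun y : Y₁ => fun g : G => b (g • y)) := by
  rw [span_shadowCoeff_add_eq_sup hAst hirrA hA1 hAst' hA'1 ha ha', span_shadowCoeff_add_eq_sup hBst hirrB hB1 hBst' hB'1 hb hb']
  refine le_antisymm ?_ (inf_le_inf le_sup_left le_sup_left)
  rintro c ⟨hc0, hc1⟩
  obtain ⟨x, hx, u, hu, rfl⟩ := Submodule.mem_sup.1 hc0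
  obtain ⟨z, hz, u', hu', he⟩ := Submodule.mem_sup.1 hc1
  -- the lines are finite-dimensional right-stable subspaces of dimension `1` (when non-zero)
  haveI hfu : FiniteDimensional ℚ (Submodule.span ℚ (Set.range fun y : Y₀ => fun g : G => a' (g • y))) :=
    FiniteDimensional.span_of_finite ℚ (Set.finite_range _)
  haveI hfu' : FiniteDimensional ℚ (Submodule.span ℚ (Set.range fun y : Y₁ => fun g : G => b' (g • y))) :=
    FiniteDimensional.span_of_finite ℚ (Set.finite_range _)
  -- the sum `U = S(a) ⊔ S(b)` is right-stable and meets neither line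
  have hUst : ∀ (k : G) (d : G → ℚ), d ∈ Submodule.span ℚ (Set.range fun y : Y₀ => fun g : G => a (g • y)) ⊔
      Submodule.span ℚ (Set.range fun y : Y₁ => fun g : G => b (g • y)) →
      (fun g => d (g * k)) ∈ Submodule.span ℚ (Set.range fun y : Y₀ => fun g : G => a (g • y)) ⊔
        Submodule.span ℚ (Set.range fun y : Y₁ => fun g : G => b (g • y)) := by
    intro k d hd
    obtain ⟨p, hp, q, hq, rfl⟩ := Submodule.mem_sup.1 hd
    have e : (fun g => (p + q) (g * k)) = (fun g => p (g * k)) + fun g => q (g * k) := rfl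
    rw [e]
    exact Submodule.add_mem_sup (translate_shadowCoeff_mem a k hp) (translate_shadowCoeff_mem b k hq)
  -- `u = 0`: otherwise separate by a character value
  have hd : u - u' ∈ Submodule.span ℚ (Set.range fun y : Y₀ => fun g : G => a (g • y)) ⊔
      Submodule.span ℚ (Set.range fun y : Y₁ => fun g : G => b (g • y)) := by
    have e : u - u' = z - x := by
      have := he  -- z + u' = x + u
      funext g; have hg := congrFun this g; simp only [Pi.add_apply, Pi.sub_apply] at hg ⊢; linarith
    rw [e]
    exact Submodule.sub_mem _ (Submodule.mem_sup_right hz) (Submodule.mem_sup_left hx)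
  -- membership of a line element in `U` forces it to vanish
  have hvanish₀ : ∀ v ∈ Submodule.span ℚ (Set.range fun y : Y₀ => fun g : G => a' (g • y)),
      v ∈ Submodule.span ℚ (Set.range fun y : Y₀ => fun g : G => a (g • y)) ⊔
        Submodule.span ℚ (Set.range fun y : Y₁ => fun g : G => b (g • y)) → v = 0 := by
    intro v hv hvU
    by_cases ha'0 : a' = 0
    · rw [(span_shadowCoeff_eq_bot_iff (G := G) a').2 ha'0, Submodule.mem_bot] at hv; exact hv
    have h := inf_sup_eq_bot_of_finrank_eq_one hAst hirrA hA1 hBst hirrB hB1 ha hb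
      (finrank_span_shadowCoeff_eq_one hAst' hA'1 ha' ha'0) (fun k c hc => translate_shadowCoeff_mem a' k hc)
    have hmem : v ∈ Submodule.span ℚ (Set.range fun y : Y₀ => fun g : G => a' (g • y)) ⊓
        (Submodule.span ℚ (Set.range fun y : Y₀ => fun g : G => a (g • y)) ⊔
          Submodule.span ℚ (Set.range fun y : Y₁ => fun g : G => b (g • y))) := ⟨hv, hvU⟩
    rw [h] at hmem
    exact (Submodule.mem_bot ℚ).1 hmem
  have hvanish₁ : ∀ v ∈ Submodule.span ℚ (Set.range fun y : Y₁ => fun g : G => b' (g • y)),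
      v ∈ Submodule.span ℚ (Set.range fun y : Y₀ => fun g : G => a (g • y)) ⊔
        Submodule.span ℚ (Set.range fun y : Y₁ => fun g : G => b (g • y)) → v = 0 := by
    intro v hv hvU
    by_cases hb'0 : b' = 0
    · rw [(span_shadowCoeff_eq_bot_iff (G := G) b').2 hb'0, Submodule.mem_bot] at hv; exact hv
    have h := inf_sup_eq_bot_of_finrank_eq_one hAst hirrA hA1 hBst hirrB hB1 ha hb
      (finrank_span_shadowCoeff_eq_one hBst' hB'1 hb' hb'0) (fun k c hc => translate_shadowCoeff_mem b' k hc)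
    have hmem : v ∈ Submodule.span ℚ (Set.range fun y : Y₁ => fun g : G => b' (g • y)) ⊓
        (Submodule.span ℚ (Set.range fun y : Y₀ => fun g : G => a (g • y)) ⊔
          Submodule.span ℚ (Set.range fun y : Y₁ => fun g : G => b (g • y))) := ⟨hv, hvU⟩
    rw [h] at hmem
    exact (Submodule.mem_bot ℚ).1 hmem
  -- main case analysis
  have hu0 : u = 0 := by
    by_contra hu0
    by_cases hu'0 : u' = 0
    · rw [hu'0, sub_zero] at hd
      exact hu0 (hvanish₀ u hu hd)
    -- both non-zero: characters
    have ha'0 : a' ≠ 0 := fun h0 => hu0 (by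
      rw [(span_shadowCoeff_eq_bot_iff (G := G) a').2 h0, Submodule.mem_bot] at hu; exact hu)
    have hb'0 : b' ≠ 0 := fun h0 => hu'0 (by
      rw [(span_shadowCoeff_eq_bot_iff (G := G) b').2 h0, Submodule.mem_bot] at hu'; exact hu')
    have hε₀ := fun k => exists_translate_eq_smul_of_finrank_eq_one
      (finrank_span_shadowCoeff_eq_one hAst' hA'1 ha' ha'0) (fun k c hc => translate_shadowCoeff_mem a' k hc) hu k
    have hε₁ := fun k => exists_translate_eq_smul_of_finrank_eq_one
      (finrank_span_shadowCoeff_eq_one hBst' hB'1 hb' hb'0) (fun k c hc => translate_shadowCoeff_mem b' k hc) hu' k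
    choose ε₀ hε₀ using hε₀
    choose ε₁ hε₁ using hε₁
    by_cases hdiff : ∃ k, ε₀ k ≠ ε₁ k
    · obtain ⟨k, hk⟩ := hdiff
      -- `R_k(u − u′) − ε₁(k)(u − u′) = (ε₀(k) − ε₁(k)) u ∈ U`
      have hmem : (ε₀ k - ε₁ k) • u ∈ Submodule.span ℚ (Set.range fun y : Y₀ => fun g : G => a (g • y)) ⊔
          Submodule.span ℚ (Set.range fun y : Y₁ => fun g : G => b (g • y)) := by
        have e : (ε₀ k - ε₁ k) • u = (fun g => (u - u') (g * k)) - ε₁ k • (u - u') := by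
          funext g
          have h0 := congrFun (hε₀ k) g
          have h1 := congrFun (hε₁ k) g
          simp only [Pi.smul_apply, smul_eq_mul, Pi.sub_apply] at h0 h1 ⊢
          rw [h0, h1]; ring
        rw [e]
        exact Submodule.sub_mem _ (hUst k _ hd) (Submodule.smul_mem _ _ hd)
      have h0 := hvanish₀ _ (Submodule.smul_mem _ _ hu) hmem
      rcases smul_eq_zero.1 h0 with h | h
      · exact hk (sub_eq_zero.1 h)
      · exact hu0 h
    · push Not at hdiff
      -- equal characters: `u(g) = ε(g) u(1)` and `u′(g) = ε(g) u′(1)`, so the lines coincide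
      have hug : ∀ g : G, u g = ε₀ g * u 1 := fun g => by
        have := congrFun (hε₀ g) 1
        simp only [one_mul, Pi.smul_apply, smul_eq_mul] at this
        exact this
      have hu'g : ∀ g : G, u' g = ε₀ g * u' 1 := fun g => by
        have := congrFun (hε₁ g) 1
        simp only [one_mul, Pi.smul_apply, smul_eq_mul] at this
        rw [← hdiff g] at this
        exact this
      by_cases hu1 : u 1 = 0
      · exact hu0 (funext fun g => by rw [hug g, hu1, mul_zero]; rfl)
      · -- `u′ = (u′ 1 / u 1) • u ∈ S(a′) ⊓ S(b′) = ⊥`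
        have e : u' = (u' 1 / u 1) • u := by
          funext g
          rw [Pi.smul_apply, smul_eq_mul, hu'g g, hug g]
          field_simp
        have hmem : u' ∈ Submodule.span ℚ (Set.range fun y : Y₀ => fun g : G => a' (g • y)) ⊓
            Submodule.span ℚ (Set.range fun y : Y₁ => fun g : G => b' (g • y)) :=
          ⟨by rw [e]; exact Submodule.smul_mem _ _ hu, hu'⟩
        rw [hll] at hmem
        exact hu'0 ((Submodule.mem_bot ℚ).1 hmem)
  have hu'0 : u' = 0 := by
    rw [hu0, zero_sub] at hd
    exact hvanish₁ u' hu' ((Submodule.neg_mem_iff _).1 hd)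
  rw [hu0, add_zero]
  rw [hu0, hu'0, add_zero, add_zero] at he
  exact ⟨hx, he ▸ hz⟩

omit [DecidableEq Y₀] [DecidableEq Y₁] in
/-- **QUANTISATION with invisible characters**: under the same hypotheses
`dim(S(a₀ + a₀′) ∩ S(a₁ + a₁′)) ∈ {0, dim A₀}`. [cite: Serre1977, §2.6] -/
theorem finrank_inf_eq_zero_or_eq_of_lines_disjoint {A A' : Submodule ℚ (Y₀ → ℚ)} {B B' : Submodule ℚ (Y₁ → ℚ)}
    (hAst : ∀ (k : G) (a : Y₀ → ℚ), a ∈ A → (fun y => a (k • y)) ∈ A)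
    (hirrA : ∀ W : Submodule ℚ (Y₀ → ℚ), W ≤ A → W ≠ ⊥ →
      (∀ (k : G) (f : Y₀ → ℚ), f ∈ W → (fun y => f (k • y)) ∈ W) → W = A)
    (hA1 : Module.finrank ℚ A ≠ 1)
    (hAst' : ∀ (k : G) (a : Y₀ → ℚ), a ∈ A' → (fun y => a (k • y)) ∈ A') (hA'1 : Module.finrank ℚ A' = 1)
    (hBst : ∀ (k : G) (b : Y₁ → ℚ), b ∈ B → (fun y => b (k • y)) ∈ B)
    (hirrB : ∀ W : Submodule ℚ (Y₁ → ℚ), W ≤ B → W ≠ ⊥ →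
      (∀ (k : G) (f : Y₁ → ℚ), f ∈ W → (fun y => f (k • y)) ∈ W) → W = B)
    (hB1 : Module.finrank ℚ B ≠ 1)
    (hBst' : ∀ (k : G) (b : Y₁ → ℚ), b ∈ B' → (fun y => b (k • y)) ∈ B') (hB'1 : Module.finrank ℚ B' = 1)
    {a a' : Y₀ → ℚ} {b b' : Y₁ → ℚ} (ha : a ∈ A) (ha' : a' ∈ A') (hb : b ∈ B) (hb' : b' ∈ B')
    (hll : Submodule.span ℚ (Set.range fun y : Y₀ => fun g : G => a' (g • y)) ⊓
      Submodule.span ℚ (Set.range fun y : Y₁ => fun g : G => b' (g • y)) = ⊥) :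
    Module.finrank ℚ (Submodule.span ℚ (Set.range fun y : Y₀ => fun g : G => (a + a') (g • y)) ⊓
        Submodule.span ℚ (Set.range fun y : Y₁ => fun g : G => (b + b') (g • y)) : Submodule ℚ (G → ℚ)) = 0 ∨
      Module.finrank ℚ (Submodule.span ℚ (Set.range fun y : Y₀ => fun g : G => (a + a') (g • y)) ⊓
        Submodule.span ℚ (Set.range fun y : Y₁ => fun g : G => (b + b') (g • y)) : Submodule ℚ (G → ℚ)) =
        Module.finrank ℚ A := by
  rw [span_shadowCoeff_add_inf_eq_of_lines_disjoint hAst hirrA hA1 hAst' hA'1 hBst hirrB hB1 hBst' hB'1 ha ha' hb hb' hll]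
  exact finrank_span_shadowCoeff_inf_eq_zero_or_eq hAst hirrA hBst hirrB ha hb

variable {I : Type u} {E : I → Type v} [∀ i, MulAction G (E i)] [∀ i, Fintype (E i)] [Fintype I] [∀ i, Nonempty (E i)]

/-- **TYPE RANKS: quadratic characters never contribute unless shared.**  Two slots with equivariant pivots refining
the trace classes whose shadows decompose as `w_κ = a_κ + a_κ′` (`a_κ` in a stable irreducible module of dimension `≠ 1`,
`a_κ′` on a stable line), the two lines disjoint ⟹ `rank Φ₀ + rank Φ₁ = rank(Φ₀,Φ₁) + 1` or `= rank(Φ₀,Φ₁) + 1 + dim A₀`.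
[cite: Gordon1999HodgeAVSurvey, §3 Theorem, 7.5–7.7 and 9.4.3] [cite: Serre1977, §2.6] -/
theorem typeRank_add_typeRank_eq_or_of_lines_disjoint {ρ : G} {Φ : ∀ i, Set (E i)}
    (h : ∀ i, IsCMTypeWith ρ (Φ i)) {i₀ i₁ : I} (hI : ∀ j, j = i₀ ∨ j = i₁) (h01 : i₀ ≠ i₁)
    (r₀ : E i₀ → Y₀) (r₁ : E i₁ → Y₁) (hr₀ : ∀ (g : G) (x : E i₀), r₀ (g • x) = g • r₀ x)
    (hr₁ : ∀ (g : G) (x : E i₁), r₁ (g • x) = g • r₁ x)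
    (hfine₀ : ∀ x x' : E i₀, r₀ x = r₀ x' → ∃ n : G, (∀ y : E i₁, n • y = y) ∧ n • x = x')
    (hfine₁ : ∀ x x' : E i₁, r₁ x = r₁ x' → ∃ n : G, (∀ y : E i₀, n • y = y) ∧ n • x = x')
    {A A' : Submodule ℚ (Y₀ → ℚ)} {B B' : Submodule ℚ (Y₁ → ℚ)}
    (hAst : ∀ (k : G) (a : Y₀ → ℚ), a ∈ A → (fun y => a (k • y)) ∈ A)
    (hirrA : ∀ W : Submodule ℚ (Y₀ → ℚ), W ≤ A → W ≠ ⊥ →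
      (∀ (k : G) (f : Y₀ → ℚ), f ∈ W → (fun y => f (k • y)) ∈ W) → W = A)
    (hA1 : Module.finrank ℚ A ≠ 1)
    (hAst' : ∀ (k : G) (a : Y₀ → ℚ), a ∈ A' → (fun y => a (k • y)) ∈ A') (hA'1 : Module.finrank ℚ A' = 1)
    (hBst : ∀ (k : G) (b : Y₁ → ℚ), b ∈ B → (fun y => b (k • y)) ∈ B)
    (hirrB : ∀ W : Submodule ℚ (Y₁ → ℚ), W ≤ B → W ≠ ⊥ →
      (∀ (k : G) (f : Y₁ → ℚ), f ∈ W → (fun y => f (k • y)) ∈ W) → W = B)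
    (hB1 : Module.finrank ℚ B ≠ 1)
    (hBst' : ∀ (k : G) (b : Y₁ → ℚ), b ∈ B' → (fun y => b (k • y)) ∈ B') (hB'1 : Module.finrank ℚ B' = 1)
    {a a' : Y₀ → ℚ} {b b' : Y₁ → ℚ} (ha : a ∈ A) (ha' : a' ∈ A') (hb : b ∈ B) (hb' : b' ∈ B')
    (hll : Submodule.span ℚ (Set.range fun y : Y₀ => fun g : G => a' (g • y)) ⊓
      Submodule.span ℚ (Set.range fun y : Y₁ => fun g : G => b' (g • y)) = ⊥)
    (hw₀ : (fun y : Y₀ => ∑ x ∈ Finset.univ.filter (fun x => r₀ x = y), antiVec (Φ i₀) (1 : G) x) = a + a')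
    (hw₁ : (fun y : Y₁ => ∑ x ∈ Finset.univ.filter (fun x => r₁ x = y), antiVec (Φ i₁) (1 : G) x) = b + b') :
    typeRank G (Φ i₀) + typeRank G (Φ i₁) = typeRank G (sigmaType Φ) + 1 ∨
      typeRank G (Φ i₀) + typeRank G (Φ i₁) = typeRank G (sigmaType Φ) + 1 + Module.finrank ℚ A := by
  have hpair := typeRank_add_typeRank_eq_add_finrank_shadowCoeff_inf_shadowCoeff_of_fine h hI h01 r₀ r₁ hr₀ hr₁
    hfine₀ hfine₁
  have hS₀ : (fun y : Y₀ => fun g : G => ∑ x ∈ Finset.univ.filter (fun x => r₀ x = g • y), antiVec (Φ i₀) (1 : G) x)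
      = fun y : Y₀ => fun g : G => (a + a') (g • y) := by
    funext y; funext g; exact congrFun hw₀ (g • y)
  have hS₁ : (fun y : Y₁ => fun g : G => ∑ x ∈ Finset.univ.filter (fun x => r₁ x = g • y), antiVec (Φ i₁) (1 : G) x)
      = fun y : Y₁ => fun g : G => (b + b') (g • y) := by
    funext y; funext g; exact congrFun hw₁ (g • y)
  rw [hS₀, hS₁] at hpair
  rcases finrank_inf_eq_zero_or_eq_of_lines_disjoint (G := G) hAst hirrA hA1 hAst' hA'1 hBst hirrB hB1 hBst' hB'1
    ha ha' hb hb' hll with h0 | hA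
  · left
    rw [h0, add_zero] at hpair
    exact hpair
  · right
    rw [hA] at hpair
    exact hpair

end Summit.HodgeConjecture.CorCM.IrrOdd

end
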